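import Literature.Probability.RandomPlanarGeometry.AffineInterp
import Literature.Probability.RandomPlanarGeometry.PlanarDomainsTopology
import Literature.Topology.PlaneTopology.JordanCurveProofs
import HarnessLib

/-!
# Simple closed polygons and the Jordan domain bounded by a loop

Support file for the uniform spanning tree Peano curve of Lawler–Schramm–Werner
(`USTPeanoDomain.lean`). In [LSW04] §4.1 the lattice domain `D(α, β, a, b)` is "the (unique)
bounded connected component of `ℂ ∖ (α ∪ [α_b, β_b] ∪ β ∪ [β_a, α_a])`" for finite primal/dual
TREES `α`, `β`; when `α`, `β` are simple lattice arcs (the setting of [LSW04] §4.3, the only one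
we formalise) the removed set is a simple closed polygon and `D` is its inside, a Jordan domain.
To use the tree's uniformization results (`MarkedDomain.exists_isChordalUniformizing_holds`) we
need it as a `Literature.Probability.RandomPlanarGeometry.JordanDomain` (data: carrier + boundary
loop). This file provides:

* `icoSegment x y` (the half-open segment `[x, y)`) and `IsSimpleClosedPolygon l` — the vertex
  list `l` is nonempty, consecutive vertices are distinct (Mathlib's
  `Polygon.HasNondegenerateEdges`, see `IsSimpleClosedPolygon.hasNondegenerateEdges`) and the
  half-open edges `[l[i], l[i+1])` are pairwise disjoint — with `injOn_polygonLoop`: then the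
  closed polygon `polygonLoop l` (`AffineInterp.lean`) is injective on a period, i.e. a Jordan
  curve; `isSimpleClosedPolygon_triangle` (the triangle `0, 1, i`) shows the notion is inhabited;
* `JordanDomain.ofLoop γ` — the Jordan domain bounded by a continuous `1`-periodic loop `γ`
  injective on `[0, 1)`: its carrier is THE bounded complementary component of `range γ`, from
  the Jordan curve theorem PROVED in the tree
  (`Literature.Topology.PlaneTopology.JordanCurveTheorem_holds`); `JordanDomain.mem_ofLoop_carrier_iff`
  (`z` is inside iff `z ∉ range γ` and its complementary component is bounded),
  `JordanDomain.subset_ofLoop_carrier` (a connected set missing the curve and meeting the inside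
  lies inside);
* `JordanDomain.carrier_eq_of_frontier_eq` — two Jordan domains with the same frontier have the
  same carrier (the inside of a Jordan curve is unique), so `ofLoop` is consistent with every
  other presentation of the same region (`unitDisc`, `triangleDomain`, …);
* `polygonDomain l h` — the Jordan domain inside a simple closed polygon, its frontier
  (`frontier_polygonDomain`, the union of the closed edges) and membership criterion.

## Mathlib
`Mathlib.Geometry.Polygon.Basic` has `Polygon P n`, `Polygon.HasNondegenerateEdges`,
`Polygon.boundary`; it has no simplicity predicate, no parametrised loop and no Jordan-curve
consequences. `connectedComponentIn`, `IsPreconnected.subset_or_subset`, `Bornology.IsBounded`.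

## References
* G. F. Lawler, O. Schramm, W. Werner, *Conformal invariance of planar loop-erased random walks
  and uniform spanning trees*, Ann. Probab. 32 (2004), §4.1, §4.3.
* J. McCleary, *A First Course in Topology* (2006), Ch. 9 (Jordan curve theorem).
-/

noncomputable section

open Set Function

namespace Literature.Probability.RandomPlanarGeometry

/-! ### Simple closed polygons -/

section Simple

variable {E : Type*} [AddCommGroup E] [Module ℝ E]

/-- The **half-open segment** `[x, y) = {lineMap x y θ | 0 ≤ θ < 1}`. [folklore] -/
def icoSegment (x y : E) : Set E := AffineMap.lineMap x y '' Ico (0 : ℝ) 1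

/-- `lineMap x y θ ∈ [x, y)` for `θ ∈ [0, 1)`. [folklore] -/
theorem lineMap_mem_icoSegment {x y : E} {θ : ℝ} (hθ : θ ∈ Ico (0 : ℝ) 1) :
    AffineMap.lineMap x y θ ∈ icoSegment x y := ⟨θ, hθ, rfl⟩

/-- `x ∈ [x, y)`. [folklore] -/
theorem left_mem_icoSegment (x y : E) : x ∈ icoSegment x y :=
  ⟨0, ⟨le_rfl, one_pos⟩, by simp⟩

/-- The half-open segment lies in the closed segment. [folklore] -/
theorem icoSegment_subset_segment (x y : E) : icoSegment x y ⊆ segment ℝ x y := by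
  rintro _ ⟨θ, hθ, rfl⟩
  rw [segment_eq_image_lineMap]
  exact ⟨θ, ⟨hθ.1, hθ.2.le⟩, rfl⟩

/-- A list of vertices `[v₀, …, v_{N-1}]` spans a **simple closed polygon**: it is nonempty,
consecutive vertices (cyclically) are distinct, and the half-open edges `[v_i, v_{(i+1) % N})`
are pairwise disjoint. This is exactly injectivity of `polygonLoop l` on a period
(`injOn_polygonLoop`). The field `ne` is Mathlib's `Polygon.HasNondegenerateEdges` for the
polygon with vertices `i ↦ l[i]` (`IsSimpleClosedPolygon.hasNondegenerateEdges`). [folklore] -/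
structure IsSimpleClosedPolygon (l : List E) : Prop where
  /-- there is at least one vertex -/
  pos : 0 < l.length
  /-- consecutive vertices are distinct (nondegenerate edges) -/
  ne : ∀ (k : ℕ) (hk : k < l.length), l[k] ≠ l[(k + 1) % l.length]'(Nat.mod_lt _ (by omega))
  /-- distinct half-open edges are disjoint -/
  disjoint : ∀ (i j : ℕ) (hi : i < l.length) (hj : j < l.length), i ≠ j →
    Disjoint (icoSegment l[i] (l[(i + 1) % l.length]'(Nat.mod_lt _ (by omega))))
      (icoSegment l[j] (l[(j + 1) % l.length]'(Nat.mod_lt _ (by omega))))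

/-- To check that a polygon is simple it suffices to compare the edges `i < j`. [folklore] -/
theorem IsSimpleClosedPolygon.of_lt {l : List E} (pos : 0 < l.length)
    (ne : ∀ (k : ℕ) (hk : k < l.length), l[k] ≠ l[(k + 1) % l.length]'(Nat.mod_lt _ (by omega)))
    (disjoint : ∀ (i j : ℕ) (hi : i < l.length) (hj : j < l.length), i < j →
      Disjoint (icoSegment l[i] (l[(i + 1) % l.length]'(Nat.mod_lt _ (by omega))))
        (icoSegment l[j] (l[(j + 1) % l.length]'(Nat.mod_lt _ (by omega))))) :
    IsSimpleClosedPolygon l where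
  pos := pos
  ne := ne
  disjoint i j hi hj hij := by
    rcases lt_or_gt_of_ne hij with h | h
    · exact disjoint i j hi hj h
    · exact (disjoint j i hj hi h).symm

/-- The field `ne` is Mathlib's `Polygon.HasNondegenerateEdges`. [folklore] -/
theorem IsSimpleClosedPolygon.hasNondegenerateEdges {l : List E} (h : IsSimpleClosedPolygon l) :
    (⟨fun i : Fin l.length ↦ l[(i : ℕ)]⟩ : Polygon E l.length).HasNondegenerateEdges := by
  intro i
  have e : l[((finRotate l.length i : Fin l.length) : ℕ)] =
      l[((i : ℕ) + 1) % l.length]'(Nat.mod_lt _ h.pos) :=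
    getElem_congr_idx (val_finRotate_eq_mod i)
  change l[(i : ℕ)] ≠ l[((finRotate l.length i : Fin l.length) : ℕ)]
  rw [e]
  exact h.ne i i.2

/-- The vertices of a simple closed polygon are pairwise distinct. [folklore] -/
theorem IsSimpleClosedPolygon.getElem_ne {l : List E} (h : IsSimpleClosedPolygon l) {i j : ℕ}
    (hi : i < l.length) (hj : j < l.length) (hij : i ≠ j) : l[i] ≠ l[j] := fun heq ↦
  Set.disjoint_left.1 (h.disjoint i j hi hj hij) (left_mem_icoSegment _ _)
    (heq ▸ left_mem_icoSegment _ _)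

/-- The vertex list of a simple closed polygon has no duplicates. [folklore] -/
theorem IsSimpleClosedPolygon.nodup {l : List E} (h : IsSimpleClosedPolygon l) : l.Nodup :=
  List.nodup_iff_injective_getElem.2 fun i j hij ↦
    Fin.ext (by_contra fun hne ↦ h.getElem_ne i.2 j.2 hne hij)

/-- **A simple closed polygon is a Jordan curve**: its loop is injective on the period `[0, 1)`.
[folklore] -/
theorem injOn_polygonLoop {l : List E} (h : IsSimpleClosedPolygon l) :
    InjOn (polygonLoop l) (Ico 0 1) := by
  have hl : l ≠ [] := List.ne_nil_of_length_pos h.pos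
  intro t ht t' ht' heq
  obtain ⟨k, hk, θ, hθ, hkt, hv⟩ := polygonLoop_eq_of_floor hl t
  obtain ⟨k', hk', θ', hθ', hkt', hv'⟩ := polygonLoop_eq_of_floor hl t'
  rw [Int.fract_eq_self.2 ⟨ht.1, ht.2⟩] at hkt
  rw [Int.fract_eq_self.2 ⟨ht'.1, ht'.2⟩] at hkt'
  by_cases hkk : k = k'
  · subst hkk
    have hd : l[(k + 1) % l.length]'(Nat.mod_lt _ h.pos) - l[k] ≠ 0 :=
      sub_ne_zero.2 (h.ne k hk).symm
    have : θ = θ' := by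
      have h1 := hv.symm.trans (heq.trans hv')
      simp only [AffineMap.lineMap_apply_module', add_left_inj] at h1
      exact smul_left_injective ℝ hd h1
    rw [← hkt, ← hkt', this]
  · exfalso
    have hmem : polygonLoop l t ∈ icoSegment l[k] (l[(k + 1) % l.length]'(Nat.mod_lt _ h.pos)) :=
      hv ▸ lineMap_mem_icoSegment hθ
    have hmem' : polygonLoop l t ∈
        icoSegment l[k'] (l[(k' + 1) % l.length]'(Nat.mod_lt _ h.pos)) :=
      heq ▸ hv' ▸ lineMap_mem_icoSegment hθ'
    exact Set.disjoint_left.1 (h.disjoint k k' hk hk' hkk) hmem hmem'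

end Simple

/-- **The triangle `0, 1, i` is a simple closed polygon** (so `IsSimpleClosedPolygon` and
`polygonDomain` are inhabited). [folklore] -/
theorem isSimpleClosedPolygon_triangle : IsSimpleClosedPolygon [(0 : ℂ), 1, Complex.I] := by
  refine IsSimpleClosedPolygon.of_lt (by simp) ?_ ?_
  · intro k hk
    have : k < 3 := by simpa using hk
    interval_cases k <;> simp [Complex.ext_iff]
  · intro i j hi hj hij
    have hj3 : j < 3 := by simpa using hj
    interval_cases j <;> interval_cases i <;>
    · simp only [List.length_cons, List.length_nil, Nat.reduceAdd, Nat.reduceMod,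
        List.getElem_cons_zero, List.getElem_cons_succ, Set.disjoint_left]
      rintro _ ⟨θ, ⟨hθ0, hθ1⟩, rfl⟩ ⟨θ', ⟨hθ0', hθ1'⟩, h⟩
      have hre := congrArg Complex.re h
      have him := congrArg Complex.im h
      simp [AffineMap.lineMap_apply_module'] at hre him
      nlinarith

/-! ### The Jordan domain bounded by a loop -/

namespace JordanDomain

open Bornology

section OfLoop

variable {γ : ℝ → ℂ} (hγ : Continuous γ) (hp : γ.Periodic 1) (hinj : InjOn γ (Ico 0 1))

/-- **The Jordan domain bounded by a Jordan curve** given as a continuous `1`-periodic loop `γ`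
injective on `[0, 1)`: the carrier is the bounded complementary component of `range γ` (from the
Jordan curve theorem, proved in the tree as
`Literature.Topology.PlaneTopology.JordanCurveTheorem_holds`), the boundary loop is `γ`.
McCleary (2006), Ch. 9. [folklore] -/
def ofLoop : JordanDomain where
  carrier :=
    (Literature.Topology.PlaneTopology.JordanCurveTheorem_holds.of_periodic hγ hp hinj).choose
  boundary := γ
  isOpen := (Literature.Topology.PlaneTopology.JordanCurveTheorem_holds.of_periodic
    hγ hp hinj).choose_spec.choose_spec.1
  isBounded := (Literature.Topology.PlaneTopology.JordanCurveTheorem_holds.of_periodic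
    hγ hp hinj).choose_spec.choose_spec.2.2.2.2.2.2.2.2.1
  isConnected := (Literature.Topology.PlaneTopology.JordanCurveTheorem_holds.of_periodic
    hγ hp hinj).choose_spec.choose_spec.2.2.1
  continuous_boundary := hγ
  periodic_boundary := hp
  injOn_boundary := hinj
  range_boundary := (Literature.Topology.PlaneTopology.JordanCurveTheorem_holds.of_periodic
    hγ hp hinj).choose_spec.choose_spec.2.2.2.2.2.2.1.symm

/-- The boundary loop of `ofLoop γ` is `γ`. [folklore] -/
@[simp] theorem ofLoop_boundary : (ofLoop hγ hp hinj).boundary = γ := rfl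

/-- The frontier of `ofLoop γ` is the curve `range γ`. [folklore] -/
theorem frontier_ofLoop_carrier : frontier (ofLoop hγ hp hinj).carrier = range γ :=
  (ofLoop hγ hp hinj).range_boundary.symm

/-- The inside misses the curve. [folklore] -/
theorem ofLoop_carrier_subset_compl : (ofLoop hγ hp hinj).carrier ⊆ (range γ)ᶜ := by
  rw [← frontier_ofLoop_carrier hγ hp hinj]
  exact Set.disjoint_left.1 (ofLoop hγ hp hinj).disjoint_carrier_frontier

/-- **Inside = bounded complementary component.** A point lies in the carrier of `ofLoop γ` iff
it is off the curve and its connected component in the complement of the curve is bounded —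
the description "the bounded connected component of `ℂ ∖ (curve)`" of [LSW04] §4.1.
[folklore] -/
theorem mem_ofLoop_carrier_iff {z : ℂ} :
    z ∈ (ofLoop hγ hp hinj).carrier ↔
      z ∉ range γ ∧ IsBounded (connectedComponentIn (range γ)ᶜ z) := by
  set D := ofLoop hγ hp hinj
  obtain ⟨V, hVo, hVc, hDV, hunion, -, hVb⟩ :=
    D.exists_outside Literature.Topology.PlaneTopology.JordanCurveTheorem_holds
  rw [frontier_ofLoop_carrier] at hunion
  constructor
  · intro hz
    have hzC : z ∉ range γ := ofLoop_carrier_subset_compl hγ hp hinj hz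
    refine ⟨hzC, D.isBounded.subset ?_⟩
    -- the component of `z` is connected, misses the curve and meets `D`, so lies in `D`
    have hsub : connectedComponentIn (range γ)ᶜ z ⊆ D.carrier ∪ V :=
      hunion ▸ connectedComponentIn_subset _ _
    rcases isPreconnected_connectedComponentIn.subset_or_subset D.isOpen hVo hDV hsub with h | h
    · exact h
    · exact absurd (h (mem_connectedComponentIn hzC)) (Set.disjoint_left.1 hDV hz)
  · rintro ⟨hzC, hb⟩
    have hz : z ∈ D.carrier ∪ V := by rw [hunion]; exact hzC
    rcases hz with hz | hzV
    · exact hz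
    · exfalso
      refine hVb (hb.subset ?_)
      exact hVc.isPreconnected.subset_connectedComponentIn hzV (hunion ▸ subset_union_right)

/-- A preconnected set missing the curve and meeting the inside lies inside. [folklore] -/
theorem subset_ofLoop_carrier {S : Set ℂ} (hS : IsPreconnected S) (hSC : S ⊆ (range γ)ᶜ)
    {z : ℂ} (hzS : z ∈ S) (hz : z ∈ (ofLoop hγ hp hinj).carrier) :
    S ⊆ (ofLoop hγ hp hinj).carrier := by
  intro w hw
  rw [mem_ofLoop_carrier_iff] at hz ⊢
  refine ⟨hSC hw, ?_⟩
  rw [← connectedComponentIn_eq (hS.subset_connectedComponentIn hzS hSC hw)]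
  exact hz.2

end OfLoop

/-- **The inside of a Jordan curve is unique**: two Jordan domains with the same frontier have
the same carrier. (Each carrier is a bounded complementary component of the common boundary
curve, the complement of the curve is `carrier ∪ outside` for both, and the outsides are the
unbounded components.) In particular `ofLoop D.boundary … = D.carrier` for every Jordan domain
`D`. [folklore] -/
theorem carrier_eq_of_frontier_eq {D D' : JordanDomain}
    (h : frontier D.carrier = frontier D'.carrier) : D.carrier = D'.carrier := by
  -- it suffices to prove one inclusion, by symmetry
  suffices key : ∀ {D D' : JordanDomain}, frontier D.carrier = frontier D'.carrier →
      D'.carrier ⊆ D.carrier from (key h.symm).antisymm (key h)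
  intro D D' h
  obtain ⟨V, hVo, hVc, hDV, hunion, -, hVb⟩ :=
    D.exists_outside Literature.Topology.PlaneTopology.JordanCurveTheorem_holds
  obtain ⟨V', -, hV'c, -, hunion', -, hV'b⟩ :=
    D'.exists_outside Literature.Topology.PlaneTopology.JordanCurveTheorem_holds
  rw [← h] at hunion'
  -- `D'` is connected and misses the curve, so it lies in `D` or in `V`
  have hD'sub : D'.carrier ⊆ D.carrier ∪ V := by
    rw [hunion, ← hunion']
    exact subset_union_left
  rcases D'.isConnected.isPreconnected.subset_or_subset D.isOpen hVo hDV hD'sub with h1 | h1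
  · exact h1
  · exfalso
    -- then the unbounded `V'` also lies in `V` (it cannot lie in the bounded `D`), so
    -- `D ∪ V = D' ∪ V' ⊆ V`, contradicting `D ≠ ∅`, `D ∩ V = ∅`
    have hV'sub : V' ⊆ D.carrier ∪ V := by
      rw [hunion, ← hunion']
      exact subset_union_right
    have hV'V : V' ⊆ V := by
      rcases hV'c.isPreconnected.subset_or_subset D.isOpen hVo hDV hV'sub with h2 | h2
      · exact absurd (D.isBounded.subset h2) hV'b
      · exact h2
    obtain ⟨z, hz⟩ := D.nonempty
    have hz' : z ∈ D'.carrier ∪ V' := by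
      rw [hunion', ← hunion]
      exact Or.inl hz
    rcases hz' with hz' | hz'
    · exact Set.disjoint_left.1 hDV hz (h1 hz')
    · exact Set.disjoint_left.1 hDV hz (hV'V hz')

/-- `ofLoop` applied to the boundary of a Jordan domain gives back its carrier. [folklore] -/
theorem ofLoop_carrier_self (D : JordanDomain) :
    (ofLoop D.continuous_boundary D.periodic_boundary D.injOn_boundary).carrier = D.carrier :=
  carrier_eq_of_frontier_eq (by rw [frontier_ofLoop_carrier, D.range_boundary])

end JordanDomain

/-! ### The Jordan domain of a simple closed polygon -/

section Polygon

/-- **The polygonal Jordan domain** bounded by the simple closed polygon through `l`: the inside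
of `polygonLoop l` (`JordanDomain.ofLoop`). This is how the lattice domains `D(α, β, a, b)` of
[LSW04] §4.1 ("the unique bounded connected component of `ℂ ∖ (α ∪ [α_b, β_b] ∪ β ∪ [β_a, α_a])`")
are realised when `α`, `β` are simple lattice paths (§4.3). [folklore] -/
def polygonDomain (l : List ℂ) (h : IsSimpleClosedPolygon l) : JordanDomain :=
  JordanDomain.ofLoop (continuous_polygonLoop l) (periodic_polygonLoop l) (injOn_polygonLoop h)

/-- The boundary loop of the polygonal domain is the closed polygon. [folklore] -/
@[simp] theorem polygonDomain_boundary (l : List ℂ) (h : IsSimpleClosedPolygon l) :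
    (polygonDomain l h).boundary = polygonLoop l := rfl

/-- The frontier of the polygonal domain is the closed polygon. [folklore] -/
theorem frontier_polygonDomain_eq_range (l : List ℂ) (h : IsSimpleClosedPolygon l) :
    frontier (polygonDomain l h).carrier = range (polygonLoop l) :=
  JordanDomain.frontier_ofLoop_carrier _ _ _

/-- The frontier of the polygonal domain is the union of the closed edges. [folklore] -/
theorem frontier_polygonDomain (l : List ℂ) (h : IsSimpleClosedPolygon l) :
    frontier (polygonDomain l h).carrier = ⋃ k : Fin l.length,
      segment ℝ (l[(k : ℕ)]) (l[((k : ℕ) + 1) % l.length]'(Nat.mod_lt _ k.pos)) := by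
  rw [frontier_polygonDomain_eq_range, range_polygonLoop (List.ne_nil_of_length_pos h.pos)]

/-- Membership in the polygonal domain: off the polygon, in a bounded complementary component.
[folklore] -/
theorem mem_polygonDomain_iff (l : List ℂ) (h : IsSimpleClosedPolygon l) {z : ℂ} :
    z ∈ (polygonDomain l h).carrier ↔ z ∉ range (polygonLoop l) ∧
      Bornology.IsBounded (connectedComponentIn (range (polygonLoop l))ᶜ z) :=
  JordanDomain.mem_ofLoop_carrier_iff _ _ _

/-- **Inside test**: a bounded open set `S` missing the polygon whose frontier lies on the
polygon is inside (the complementary component of any of its points cannot leave `S` without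
crossing `frontier S`, hence is bounded). Used with `S` a region described by finitely many strict
affine inequalities. [folklore] -/
theorem subset_polygonDomain_of_frontier_subset (l : List ℂ) (h : IsSimpleClosedPolygon l)
    {S : Set ℂ} (hSo : IsOpen S) (hSb : Bornology.IsBounded S)
    (hS : frontier S ⊆ range (polygonLoop l)) (hSl : Disjoint S (range (polygonLoop l))) :
    S ⊆ (polygonDomain l h).carrier := by
  intro z hz
  rw [mem_polygonDomain_iff]
  have hzC : z ∉ range (polygonLoop l) := Set.disjoint_left.1 hSl hz
  refine ⟨hzC, hSb.subset ?_⟩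
  -- the component `K` of `z` misses `frontier S ⊆ polygon` and meets the open `S`, so `K ⊆ S`
  set K := connectedComponentIn (range (polygonLoop l))ᶜ z
  have hK : IsPreconnected K := isPreconnected_connectedComponentIn
  have hKf : Disjoint K (frontier S) := Set.disjoint_left.2 fun w hw hwf ↦
    (connectedComponentIn_subset _ _ hw) (hS hwf)
  have hKsub : K ⊆ S ∪ (closure S)ᶜ := by
    intro w hw
    by_contra hw'
    simp only [mem_union, mem_compl_iff, not_or, not_not] at hw'
    exact Set.disjoint_left.1 hKf hw ⟨hw'.2, by rw [hSo.interior_eq]; exact hw'.1⟩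
  exact hK.subset_left_of_subset_union hSo isClosed_closure.isOpen_compl
    (Set.disjoint_left.2 fun w hw hw' ↦ hw' (subset_closure hw)) hKsub
    ⟨z, mem_connectedComponentIn hzC, hz⟩

/-- **Identifying the inside**: a bounded open NONEMPTY set `S` missing the polygon whose
frontier lies on the polygon is exactly the inside. (By the previous lemma `S` is inside; the
inside is connected, misses the polygon, hence lies in `S ∪ (closure S)ᶜ` and meets `S`.) This is
how a polygonal domain given combinatorially is identified with a region given by inequalities.
[folklore] -/
theorem polygonDomain_carrier_eq (l : List ℂ) (h : IsSimpleClosedPolygon l)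
    {S : Set ℂ} (hSo : IsOpen S) (hSb : Bornology.IsBounded S) (hSn : S.Nonempty)
    (hS : frontier S ⊆ range (polygonLoop l)) (hSl : Disjoint S (range (polygonLoop l))) :
    (polygonDomain l h).carrier = S := by
  have hsub : S ⊆ (polygonDomain l h).carrier :=
    subset_polygonDomain_of_frontier_subset l h hSo hSb hS hSl
  refine Subset.antisymm ?_ hsub
  set D := polygonDomain l h
  have hDC : D.carrier ⊆ (range (polygonLoop l))ᶜ := by
    rw [← frontier_polygonDomain_eq_range l h]
    exact Set.disjoint_left.1 D.disjoint_carrier_frontier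
  have hDsub : D.carrier ⊆ S ∪ (closure S)ᶜ := by
    intro w hw
    by_contra hw'
    simp only [mem_union, mem_compl_iff, not_or, not_not] at hw'
    exact hDC hw (hS ⟨hw'.2, by rw [hSo.interior_eq]; exact hw'.1⟩)
  obtain ⟨z, hz⟩ := hSn
  exact D.isConnected.isPreconnected.subset_left_of_subset_union hSo
    isClosed_closure.isOpen_compl
    (Set.disjoint_left.2 fun w hw hw' ↦ hw' (subset_closure hw)) hDsub ⟨z, hsub hz, hz⟩

end Polygon

end Literature.Probability.RandomPlanarGeometry
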